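import Literature.Barriers.AnomalousDissipation.ShearFlowViscositySelectionLimit
import Literature.Barriers.AnomalousDissipation.ShearFlowViscositySelectionHolds

/-!
# Discharge of named literature fact(s) by composition

This file only composes reductions and discharges that are already in the tree
(no new definitions, no new named facts): each `theorem X_holds : X` below feeds the
proved hypotheses into an existing reduction theorem.  Net effect: the listed facts
stop being literature debt.
-/

namespace Literature.Barriers.AnomalousDissipation

/-- Discharge of `BardosTitiWiedemann2012_thm5_subseqLimit` (the subsequential-limit form of
Bardos–Titi–Wiedemann 2012, Thm. 5) from the proved full statement
`BardosTitiWiedemann2012_thm5_holds` via `BardosTitiWiedemann2012_thm5_subseqLimit_of_thm5`.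
[cite: BardosTitiWiedemann2012, Thm. 5, proof] -/
theorem BardosTitiWiedemann2012_thm5_subseqLimit_holds :
    BardosTitiWiedemann2012_thm5_subseqLimit :=
  BardosTitiWiedemann2012_thm5_subseqLimit_of_thm5 BardosTitiWiedemann2012_thm5_holds

end Literature.Barriers.AnomalousDissipation
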